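import Summits.CriticalPhenomena.PercolationContinuityZ3.Theorems.PercNearOneGluingNoHeavyLowerTailStarSetMixedLevelTwo
import Summits.CriticalPhenomena.PercolationContinuityZ3.Theorems.PercNearOneGluingNoHeavyLowerTailStarSetNestedCertificateCore
import HarnessLib

/-!
# `NoHeavyLowerTail` (stmt-CriticalPhenomena-4575) — OES at level `j ≤ 2`: class forest plus LIGHT chords (unconditional)

Support file (prover `prim-gen-swap` gen 9; `--supports stmt-CriticalPhenomena-4575`).  No definitions, no named facts, no sorries.

The mixed certificate `StarSet.setCS_twoPortStarMultigraph_mixed_levelTwo` needs the two supply inequalities U0'/U1'_r (seat memo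
MWF-CERT.md §3).  Both hold trivially — with no hair budget at all — as soon as the total chord price is at most the probability that the
whole forest is closed: `Σ_{K chord} Θ_K · Zfar_K ≤ Π_{I forest} (1 − Θ_I)` (the nested forest coefficients telescope to `1 − Π_I (1 − Θ_I)`,
`StarSet.nestedCoeff_sum`).  This single unconditional theorem contains both the class-forest theorem (…StarSetClassForestLevelTwo: no chords)
and the light pair-row theorem (…StarSetPairRowLight: no forest, `Σ_K Θ_K Zfar_K ≤ 1`):

* `StarSet.setCS_twoPortStarMultigraph_mixedLight_levelTwo` — classes `Fin (Mf + Mc)`, the first `Mf` a class forest in leaf-peeling order,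
  `Σ_{K < Mc} Θ_K Zfar_K ≤ Π_{I < Mf}(1 − Θ_I)` ⇒ `μ(c ↮ S, 1 ≤ |π(S)| ≤ j) ≤ μ(c ↮ S, |π(c)| ≤ j)`.
-/

noncomputable section

namespace Summit.CriticalPhenomena.PercolationContinuityZ3.Theorems

open MeasureTheory Set Literature.Probability.LatticeModels Literature.Probability.Percolation
open scoped Classical BigOperators

variable {n m Mf Mc : ℕ}

namespace StarSet

/-- **OES at level `j ≤ 2` for a class forest plus light chords** (see the file header).
[cite: VandenbergHaggstromKahn2005, Thm. 1.5 (p. 7) — the only non-elementary input, via `observerSet_le_of_lonelier`] -/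
theorem setCS_twoPortStarMultigraph_mixedLight_levelTwo (w : Sym2 (Fin n) → unitInterval) (A : Finset (Fin n)) (s p p' : Fin m → Fin n)
    (cls : Fin m → Fin (Mf + Mc)) (P P' : Fin (Mf + Mc) → Fin n) (hP : ∀ i, p i = P (cls i)) (hP' : ∀ i, p' i = P' (cls i))
    (c : Fin n) (j : ℕ) (hj : j ≤ 2) (hs : Function.Injective s) (hsA : ∀ i, s i ∉ A)
    (hPA : ∀ I, P I ∈ A) (hP'A : ∀ I, P' I ∈ A) (hPP' : ∀ I, P I ≠ P' I)
    (hnopar : ∀ I K : Fin (Mf + Mc), I ≠ K → ¬ ((P K = P I ∨ P K = P' I) ∧ (P' K = P I ∨ P' K = P' I)))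
    (hforest : ∀ K I : Fin Mf, K < I → P' (Fin.castAdd Mc K) ≠ P (Fin.castAdd Mc I) ∧ P' (Fin.castAdd Mc K) ≠ P' (Fin.castAdd Mc I))
    (hcA : c ∈ A) (hcP : ∀ I, c ≠ P I ∧ c ≠ P' I)
    (hobs : ∀ i u, u ≠ s i → u ≠ p i → u ≠ p' i → w s(s i, u) = 0)
    (hdom : ∀ I,
      (prodBernoulli w).real {ω : BondConfig (Fin n) | (A.filter fun z => ω ∈ openConn (P I) z).card ≤ j} ≤
          (prodBernoulli w).real {ω : BondConfig (Fin n) | (A.filter fun z => ω ∈ openConn c z).card ≤ j} ∧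
        (prodBernoulli w).real {ω : BondConfig (Fin n) | (A.filter fun z => ω ∈ openConn (P' I) z).card ≤ j} ≤
          (prodBernoulli w).real {ω : BondConfig (Fin n) | (A.filter fun z => ω ∈ openConn c z).card ≤ j})
    (hlight : ∑ K : Fin Mc, ((1 - ∏ i ∈ Finset.univ.filter (fun i => cls i = Fin.natAdd Mf K), (1 - (w s(s i, p i) : ℝ) * w s(s i, p' i))) *
          ∏ κ' ∈ Finset.univ.filter (fun κ' => ¬ (P κ' = P (Fin.natAdd Mf K) ∨ P κ' = P' (Fin.natAdd Mf K) ∨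
              P' κ' = P (Fin.natAdd Mf K) ∨ P' κ' = P' (Fin.natAdd Mf K))),
            ∏ i ∈ Finset.univ.filter (fun i => cls i = κ'), (1 - (w s(s i, p i) : ℝ) * w s(s i, p' i))) ≤
      ∏ I : Fin Mf, ∏ i ∈ Finset.univ.filter (fun i => cls i = Fin.castAdd Mc I), (1 - (w s(s i, p i) : ℝ) * w s(s i, p' i))) :
    (prodBernoulli w).real {ω : BondConfig (Fin n) | (∀ x ∈ Finset.univ.image s, ω ∉ openConn c x) ∧
        1 ≤ (A.filter fun z => ∃ x ∈ Finset.univ.image s, ω ∈ openConn x z).card ∧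
        (A.filter fun z => ∃ x ∈ Finset.univ.image s, ω ∈ openConn x z).card ≤ j} ≤
      (prodBernoulli w).real {ω : BondConfig (Fin n) | (∀ x ∈ Finset.univ.image s, ω ∉ openConn c x) ∧
        (A.filter fun z => ω ∈ openConn c z).card ≤ j} := by
  set θ : Fin m → ℝ := fun i => (w s(s i, p i) : ℝ) * w s(s i, p' i) with hθ
  have hθ0 : ∀ i, 0 ≤ θ i := fun i => mul_nonneg (w _).2.1 (w _).2.1
  have hθ1 : ∀ i, θ i ≤ 1 := fun i => mul_le_one₀ (w _).2.2 (w _).2.1 (w _).2.2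
  set uu : Fin (Mf + Mc) → ℝ := fun κ => ∏ i ∈ Finset.univ.filter (fun i => cls i = κ), (1 - θ i) with huu
  have huu0 : ∀ κ, 0 ≤ uu κ := fun κ => Finset.prod_nonneg fun i _ => sub_nonneg.2 (hθ1 i)
  have huu1 : ∀ κ, uu κ ≤ 1 := fun κ => Finset.prod_le_one (fun i _ => sub_nonneg.2 (hθ1 i)) fun i _ => sub_le_self _ (hθ0 i)
  set D : Fin Mc → ℝ := fun K => (1 - uu (Fin.natAdd Mf K)) *
    ∏ κ' ∈ Finset.univ.filter (fun κ' => ¬ (P κ' = P (Fin.natAdd Mf K) ∨ P κ' = P' (Fin.natAdd Mf K) ∨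
      P' κ' = P (Fin.natAdd Mf K) ∨ P' κ' = P' (Fin.natAdd Mf K))), uu κ' with hD
  have hDnn : ∀ K, 0 ≤ D K := fun K => mul_nonneg (sub_nonneg.2 (huu1 _)) (Finset.prod_nonneg fun κ' _ => huu0 κ')
  set cfF : Fin Mf → ℝ := fun I => (1 - uu (Fin.castAdd Mc I)) * ∏ K ∈ Finset.univ.filter (· < I), uu (Fin.castAdd Mc K) with hcfF
  have hcfFnn : ∀ I, 0 ≤ cfF I := fun I => mul_nonneg (sub_nonneg.2 (huu1 _)) (Finset.prod_nonneg fun K _ => huu0 _)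
  -- the nested forest coefficients telescope
  have htel : ∑ I, cfF I = 1 - ∏ I, uu (Fin.castAdd Mc I) := by
    have h := nestedCoeff_sum (fun I : Fin Mf => 1 - uu (Fin.castAdd Mc I))
    simp only [sub_sub_cancel] at h
    exact h
  have htot : ∑ I, cfF I + ∑ K, D K ≤ 1 := by
    have hl : ∑ K, D K ≤ ∏ I, uu (Fin.castAdd Mc I) := hlight
    rw [htel]; linarith
  set coef : (Fin m → Fin 3) → ℝ := fun e => ∏ i, (if (w s(s i, p i) : ℝ) * w s(s i, p' i) < 1 then
      ((if e i = 1 then (w s(s i, p i) : ℝ) else 1 - w s(s i, p i)) *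
        (if e i = 2 then (w s(s i, p' i) : ℝ) else 1 - w s(s i, p' i))) / (1 - (w s(s i, p i) : ℝ) * w s(s i, p' i))
      else if e i = 1 then 1 else 0) with hcoef
  have hcoefnn : ∀ e, 0 ≤ coef e := fun e => Finset.prod_nonneg fun i _ =>
    extremeCoeff_nonneg _ _ (w _).2.1 (w _).2.2 (w _).2.1 (w _).2.2 (e i)
  set C0 : ℝ := ∏ i, (if (w s(s i, p i) : ℝ) * w s(s i, p' i) < 1 then
      ((1 - (w s(s i, p i) : ℝ)) * (1 - w s(s i, p' i))) / (1 - (w s(s i, p i) : ℝ) * w s(s i, p' i)) else 0) with hC0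
  have hC0nn : 0 ≤ C0 := by
    refine Finset.prod_nonneg fun i _ => ?_
    split_ifs with h
    · exact div_nonneg (mul_nonneg (sub_nonneg.2 (w _).2.2) (sub_nonneg.2 (w _).2.2)) (by linarith)
    · exact le_refl 0
  set Rw : (Fin m → Fin 3) → Finset (Fin n) := fun e =>
    (Finset.univ.filter fun i => e i = 1).image p ∪ (Finset.univ.filter fun i => e i = 2).image p' with hRw
  have hbnn : ∀ e, 0 ≤ (if 3 ≤ (Rw e).card then coef e else 0) := fun e => by
    split_ifs; exacts [hcoefnn e, le_refl 0]
  refine setCS_twoPortStarMultigraph_mixed_levelTwo w A s p p' cls P P' hP hP' c j hj hs hsA hPA hP'A hPP' hnopar hforest hcA hcP hobs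
    hdom ?_ ?_
  · -- U0'
    change C0 * (∑ I, cfF I + ∑ K, D K) ≤ C0 + ∑ e, (if 3 ≤ (Rw e).card then coef e else 0)
    have h1 : C0 * (∑ I, cfF I + ∑ K, D K) ≤ C0 := by
      have := mul_le_mul_of_nonneg_left htot hC0nn
      simpa using this
    have h2 : 0 ≤ ∑ e, (if 3 ≤ (Rw e).card then coef e else 0) := Finset.sum_nonneg fun e _ => hbnn e
    linarith
  · -- U1'_r
    intro r
    change C0 * (∑ I ∈ Finset.univ.filter (fun I => P (Fin.castAdd Mc I) ≠ r), cfF I +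
        ∑ K ∈ Finset.univ.filter (fun K => P (Fin.natAdd Mf K) ≠ r ∧ P' (Fin.natAdd Mf K) ≠ r), D K) ≤
      C0 + ∑ e ∈ Finset.univ.filter (fun e => r ∉ Rw e), (if 3 ≤ (Rw e).card then coef e else 0)
    have hsubF : ∑ I ∈ Finset.univ.filter (fun I => P (Fin.castAdd Mc I) ≠ r), cfF I ≤ ∑ I, cfF I :=
      Finset.sum_le_sum_of_subset_of_nonneg (Finset.filter_subset _ _) fun I _ _ => hcfFnn I
    have hsubC : ∑ K ∈ Finset.univ.filter (fun K => P (Fin.natAdd Mf K) ≠ r ∧ P' (Fin.natAdd Mf K) ≠ r), D K ≤ ∑ K, D K :=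
      Finset.sum_le_sum_of_subset_of_nonneg (Finset.filter_subset _ _) fun K _ _ => hDnn K
    have h1 : C0 * (∑ I ∈ Finset.univ.filter (fun I => P (Fin.castAdd Mc I) ≠ r), cfF I +
        ∑ K ∈ Finset.univ.filter (fun K => P (Fin.natAdd Mf K) ≠ r ∧ P' (Fin.natAdd Mf K) ≠ r), D K) ≤ C0 := by
      have := mul_le_mul_of_nonneg_left ((add_le_add hsubF hsubC).trans htot) hC0nn
      simpa using this
    have h2 : 0 ≤ ∑ e ∈ Finset.univ.filter (fun e => r ∉ Rw e), (if 3 ≤ (Rw e).card then coef e else 0) :=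
      Finset.sum_nonneg fun e _ => hbnn e
    linarith

end StarSet

end Summit.CriticalPhenomena.PercolationContinuityZ3.Theorems

end
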